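import Summits.CriticalPhenomena.PercolationContinuityZ3.Theses.PercNearOneGluing
import Literature.Probability.Percolation.PercolationEvents
import HarnessLib.Audit
import Summits.CriticalPhenomena.PercolationContinuityZ3.Theorems.PercNearOneGluingNearOneGluingVariants2411

/-! TTRL-lite variant V2454 of stmt-CriticalPhenomena-4574

(`stub_shorteningStep` of line `kn_shortening_induction`, move `specialise+small_case`:
`n := 5` fixed and `A.card = 2` assumed).  This variant is the specialisation at `n = 5` of the
already-landed sibling variant V2411 (`A.card = 2`, every `n`, `stub_shorteningStep_var2411`):
Kozma–Nitzan's shortening step (arXiv:2401.12397, Conjecture 6 / (40)) for two relays, measured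
against the old minimiser `a₀` — transport the three glued probabilities to `prodBernoulli w`
along `ω ↦ insert s(v,x) ω`, Harris for `{v ↔ A} ∩ {a₀ ↔ b}`, and the exchange inequality
`μ({a₀ ↔ b} ∩ M) ≤ μ({a₁ ↔ b} ∩ M)` for the mixed-monotone two-cluster event `M`
(van den Berg–Häggström–Kahn two-cluster conditional association), fed by the minimiser
hypothesis; see the module docstring of V2411.  No new definitions, no named facts, the
displayed induction hypothesis is not used. -/

namespace Summit.CriticalPhenomena.PercolationContinuityZ3.Theorems

open MeasureTheory Set Literature.Probability.LatticeModels Literature.Probability.Percolation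
open scoped Classical BigOperators

/-- TTRL-lite variant V2454 of `stub_shorteningStep` (stmt-CriticalPhenomena-4574, Kozma–Nitzan
Conjecture 6 with the induction hypothesis displayed): the shortening step
`μ(⋃ a ∈ A, v ↔ a) · μ(a₀ ↔ b) ≤ μ(v ↔ b)` for the glued measure `μ = prodBernoulli (w[s(v,x) ↦ 1])`
on `Fin 5` with two relays (`A.card = 2`).  Immediate from the sibling variant
`stub_shorteningStep_var2411` (case `A.card = 2`, any `n`) at `n := 5`. -/
theorem stub_shorteningStep_var2454 : ∀ (w : Sym2 (Fin 5) → unitInterval) (A : Finset (Fin 5)) (b v x a₀ : Fin 5), A.card = 2 → v ∉ A → v ≠ x → w s(v, x) = 0 → a₀ ∈ A → (∀ a ∈ A, (prodBernoulli w).real (openConn a₀ b) ≤ (prodBernoulli w).real (openConn a b)) → (∀ w' : Sym2 (Fin 5) → unitInterval, (∀ e, w e = 0 → w' e = 0) → ∀ (A' : Finset (Fin 5)) (o' b' : Fin 5) (t : ℝ), (∀ a ∈ A', t ≤ (prodBernoulli w').real (openConn a b')) → (prodBernoulli w').real (⋃ a ∈ A', openConn o' a) * t ≤ (prodBernoulli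 w').real (openConn o' b')) → (prodBernoulli (Function.update w s(v, x) 1)).real (⋃ a ∈ A, openConn v a) * (prodBernoulli (Function.update w s(v, x) 1)).real (openConn a₀ b) ≤ (prodBernoulli (Function.update w s(v, x) 1)).real (openConn v b) :=
  stub_shorteningStep_var2411 5

end Summit.CriticalPhenomena.PercolationContinuityZ3.Theorems
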